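import Summits.QuantumFields.YangMills.Theorems.LuscherReductionTwistedTraceScalingStepLocality
import Summits.QuantumFields.YangMills.Theorems.LuscherReductionTwistedTraceScalingStepHypotheses
import Summits.QuantumFields.YangMills.Theorems.LuscherReductionTwistedTraceScalingVacuumPattern
import Summits.QuantumFields.YangMills.Theorems.LuscherReductionTwistedTraceScalingGnomonicKinetic
import Summits.QuantumFields.YangMills.Theorems.FemtoTransferGapSlabGround
import HarnessLib

/-!
# The transfer step at a configuration `U`: NEAR/FAR decomposition and the near part in the gnomonic chart
# (covariant programme, brick c4(iii)-step I)

Cell `ym-fleet`, crux `TwistedTraceScaling` (stmt-QuantumFields-20203), line «twolattice», stub S-BASE, lane B = COARSE-LOWER(L₁)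
(design note `pub/ym-fleet/ym-20203-coarse-s1/LOWER-BLUEPRINT.md` §5–§6, c4).  HONEST FRAMING: measure-theoretic bookkeeping of the one-step
transfer integral on a FIXED lattice; a stub of a child of the CONDITIONAL reduction route (femto rung R2b1); not a gap, not Clay.

By right invariance of Haar (`Cov.transferApply_eq_integral_step`), `(K_β Φ)(U) = ∫ K_β(U, W·U) Φ(W·U) dW`.  Split the step `W` into
NEAR steps (`1 − u₀(W_e) ≤ δ` on every link) and FAR steps (some link with `1 − u₀(W_e) > δ`):

* `nearSet δ`, `nearInd δ` — the near steps and their indicator (closed, measurable);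
* ★ `transferApply_eq_near_add_far` — `K_βΦ(U) = ∫ 𝟙_near K Φ + ∫ 𝟙_far K Φ`;  `far_integral_le` — for `0 ≤ Φ ≤ C` and `β ≥ 0` the far part is
  `≤ e^{2β|E|} e^{−2βδ} C` (`Cov.step_integrand_le_of_far`), `far_integral_nonneg`; ★ `transferApply_near_sandwich` — the two-sided
  packaging `∫ 𝟙_near K Φ ≤ K_βΦ(U) ≤ ∫ 𝟙_near K Φ + e^{2β|E|}e^{−2βδ} C` for `0 ≤ Φ ≤ C`;
* ★ `near_integral_eq_chart` — for `δ < 1` the near part lives on the vacuum pattern of the lattice gnomonic chart (`GnChart.latPatternChart`,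
  every link `P(1, y_e)` in the open upper hemisphere): `∫ 𝟙_near K Φ dW = ∫_{(E → ℝ³)} (∏_e w(y_e)) 𝟙_near(P y) K(U, P(y)·U) Φ(P(y)·U) dy`
  (`GnChart.integral_configMeasure_eq_vacuumChart`);
* `mem_nearSet_chart_iff` — in the chart, NEAR ⟺ `(1−δ)²(1 + |y_e|²) ≤ 1` on every link, whence `sum_sq_le_of_near_chart`:
  `|y_e|² ≤ (1−δ)⁻² − 1 =: ρ_δ²` (the chart ball on which the kernel sandwich of the sequel file is stated).

## References
* E. Seiler, *Gauge Theories as a Problem of Constructive QFT…*, LNP 159 (1982), §3 (transfer matrix of lattice gauge theory). [SeilerLNP1982]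
* M. Lüscher, Nucl. Phys. B219 (1983) 233, §3. [Luscher1983]
-/

noncomputable section

open MeasureTheory Real
open Literature.MathematicalPhysics.QuantumFieldTheory
open Literature.MathematicalPhysics.QuantumLattice
open Literature.MathematicalPhysics.QuantumFieldTheory.Balaban1983to89.T4CubeChartGnomonic (gnoPoint gnoWeight gnoPoint_zero)

namespace Summit.QuantumFields.YangMills.Theorems.FemtoTransferGap.TwoLattice.Cov

open Summit.QuantumFields.YangMills.Theorems.FemtoTransferGap
open Summit.QuantumFields.YangMills.Theorems.FemtoTransferGap.TwoLattice.GnChart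

variable {L : ℕ} [NeZero L]

/-! ## §1 Near steps -/

/-- The NEAR steps at electric proximity `δ`: `1 − u₀(W_e) ≤ δ` on every link. [cite: SeilerLNP1982, §3] -/
def nearSet (δ : ℝ) : Set (GaugeConfig 3 L SU2) := {W | ∀ e, 1 - scalarPart (W e) ≤ δ}

/-- The indicator of the near steps. [cite: SeilerLNP1982, §3] -/
def nearInd (δ : ℝ) (W : GaugeConfig 3 L SU2) : ℝ := (nearSet (L := L) δ).indicator (fun _ => (1 : ℝ)) W

omit [NeZero L] in
/-- Membership. [folklore] -/
theorem mem_nearSet_iff (δ : ℝ) (W : GaugeConfig 3 L SU2) : W ∈ nearSet δ ↔ ∀ e, 1 - scalarPart (W e) ≤ δ := Iff.rfl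

omit [NeZero L] in
/-- The near set is closed. [folklore] -/
theorem isClosed_nearSet (δ : ℝ) : IsClosed (nearSet (L := L) δ) := by
  have h : nearSet (L := L) δ = ⋂ e, {W : GaugeConfig 3 L SU2 | 1 - δ ≤ scalarPart (W e)} := by
    ext W; simp only [nearSet, Set.mem_setOf_eq, Set.mem_iInter]
    exact forall_congr' fun e => by constructor <;> intro h <;> linarith
  rw [h]
  exact isClosed_iInter fun e => isClosed_le continuous_const (continuous_scalarPart.comp (continuous_apply e))

/-- The near set is measurable. [folklore] -/
theorem measurableSet_nearSet (δ : ℝ) : MeasurableSet (nearSet (L := L) δ) := by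
  haveI : SecondCountableTopology SU2 := secondCountableTopology_su2
  exact (isClosed_nearSet δ).measurableSet

omit [NeZero L] in
/-- The indicator on near steps. [folklore] -/
theorem nearInd_of_mem {δ : ℝ} {W : GaugeConfig 3 L SU2} (h : W ∈ nearSet δ) : nearInd δ W = 1 := by
  simp [nearInd, h]

omit [NeZero L] in
/-- The indicator off near steps. [folklore] -/
theorem nearInd_of_not_mem {δ : ℝ} {W : GaugeConfig 3 L SU2} (h : W ∉ nearSet δ) : nearInd δ W = 0 := by
  simp [nearInd, h]

omit [NeZero L] in
/-- `0 ≤ 𝟙_near ≤ 1`. [folklore] -/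
theorem nearInd_mem_Icc (δ : ℝ) (W : GaugeConfig 3 L SU2) : 0 ≤ nearInd δ W ∧ nearInd δ W ≤ 1 := by
  by_cases h : W ∈ nearSet δ
  · rw [nearInd_of_mem h]; norm_num
  · rw [nearInd_of_not_mem h]; norm_num

/-- The indicator is measurable. [folklore] -/
theorem measurable_nearInd (δ : ℝ) : Measurable (nearInd (L := L) δ) :=
  measurable_const.indicator (measurableSet_nearSet δ)

omit [NeZero L] in
/-- Off the near set some link is far: `W ∉ nearSet δ ⇒ ∃ e₀, δ ≤ 1 − u₀(W_{e₀})`. [folklore] -/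
theorem exists_far_of_not_mem {δ : ℝ} {W : GaugeConfig 3 L SU2} (h : W ∉ nearSet δ) : ∃ e₀, δ ≤ 1 - scalarPart (W e₀) := by
  by_contra hne
  refine h fun e => ?_
  by_contra hlt
  exact hne ⟨e, (not_le.mp hlt).le⟩

omit [NeZero L] in
/-- A near step (`δ < 1`) has every link in the OPEN upper hemisphere. [folklore] -/
theorem scalarPart_pos_of_mem {δ : ℝ} (hδ : δ < 1) {W : GaugeConfig 3 L SU2} (h : W ∈ nearSet δ) (e : Edge 3 L) :
    0 < scalarPart (W e) := by
  have := h e; linarith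

/-! ## §2 The step integrand and the near/far split -/

/-- The step integrand `W ↦ K_β(U, W·U) Φ(W·U)`. [cite: SeilerLNP1982, §3] -/
def stepIntegrand (β : ℝ) (Φ : GaugeConfig 3 L SU2 → ℝ) (U W : GaugeConfig 3 L SU2) : ℝ :=
  transferKernel su2Rep β U (W * U) * Φ (W * U)

omit [NeZero L] in
/-- Right multiplication by `U` is continuous on configurations. [folklore] -/
theorem continuous_mul_right_config (U : GaugeConfig 3 L SU2) : Continuous fun W : GaugeConfig 3 L SU2 => W * U :=
  continuous_id.mul continuous_const

/-- The step integrand is measurable in the step. [folklore] -/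
theorem measurable_stepIntegrand (β : ℝ) {Φ : GaugeConfig 3 L SU2 → ℝ} (hΦ : Measurable Φ) (U : GaugeConfig 3 L SU2) :
    Measurable (stepIntegrand β Φ U) := by
  haveI : SecondCountableTopology SU2 := secondCountableTopology_su2
  unfold stepIntegrand
  exact ((continuous_transferKernel_right β U).measurable.comp (continuous_mul_right_config U).measurable).mul
    (hΦ.comp (continuous_mul_right_config U).measurable)

/-- A uniform bound of the step integrand: `|K(U,W·U) Φ(W·U)| ≤ M·C` with `M` a bound of the kernel. [folklore] -/
theorem exists_abs_stepIntegrand_le (β : ℝ) {Φ : GaugeConfig 3 L SU2 → ℝ} {C : ℝ} (hC : ∀ V, |Φ V| ≤ C) (U : GaugeConfig 3 L SU2) :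
    ∃ B : ℝ, ∀ W, |stepIntegrand β Φ U W| ≤ B := by
  haveI : SecondCountableTopology SU2 := secondCountableTopology_su2
  obtain ⟨M, hM⟩ := exists_transferKernel_le su2Rep continuous_su2Rep β (L := L)
  refine ⟨M * C, fun W => ?_⟩
  have hK := transferKernel_pos su2Rep β U (W * U)
  rw [stepIntegrand, abs_mul, abs_of_pos hK]
  exact mul_le_mul (hM _ _) (hC _) (abs_nonneg _) (hK.le.trans (hM _ _))

/-- A bounded measurable function on the configuration space is integrable. [folklore] -/
theorem integrable_of_bounded {g : GaugeConfig 3 L SU2 → ℝ} (hg : Measurable g) {B : ℝ} (hB : ∀ W, |g W| ≤ B) :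
    Integrable g (configMeasure SU2 L) :=
  Integrable.mono' (integrable_const B) hg.aestronglyMeasurable (ae_of_all _ fun W => by rw [Real.norm_eq_abs]; exact hB W)

/-- ★ **NEAR/FAR SPLIT**: `K_βΦ(U) = ∫ 𝟙_near K(U,W·U)Φ(W·U) dW + ∫ (1 − 𝟙_near) K(U,W·U)Φ(W·U) dW`. [cite: SeilerLNP1982, §3] -/
theorem transferApply_eq_near_add_far (β δ : ℝ) {Φ : GaugeConfig 3 L SU2 → ℝ} (hΦ : Measurable Φ) {C : ℝ} (hC : ∀ V, |Φ V| ≤ C)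
    (U : GaugeConfig 3 L SU2) :
    transferApply β Φ U =
      (∫ W, nearInd δ W * stepIntegrand β Φ U W ∂configMeasure SU2 L) +
        ∫ W, (1 - nearInd δ W) * stepIntegrand β Φ U W ∂configMeasure SU2 L := by
  obtain ⟨B, hB⟩ := exists_abs_stepIntegrand_le β hC U
  have hm := measurable_stepIntegrand β hΦ U
  have hB0 : 0 ≤ B := (abs_nonneg _).trans (hB 1)
  have h1 : Integrable (fun W => nearInd δ W * stepIntegrand β Φ U W) (configMeasure SU2 L) := by
    refine integrable_of_bounded ((measurable_nearInd δ).mul hm) (B := B) fun W => ?_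
    rw [abs_mul]
    obtain ⟨h0, h1⟩ := nearInd_mem_Icc δ W
    rw [abs_of_nonneg h0]
    nlinarith [hB W, abs_nonneg (stepIntegrand β Φ U W)]
  have h2 : Integrable (fun W => (1 - nearInd δ W) * stepIntegrand β Φ U W) (configMeasure SU2 L) := by
    refine integrable_of_bounded ((measurable_const.sub (measurable_nearInd δ)).mul hm) (B := B) fun W => ?_
    rw [abs_mul]
    obtain ⟨h0, h1⟩ := nearInd_mem_Icc δ W
    rw [abs_of_nonneg (by linarith)]
    nlinarith [hB W, abs_nonneg (stepIntegrand β Φ U W)]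
  rw [transferApply_eq_integral_step, ← integral_add h1 h2]
  refine integral_congr_ae (ae_of_all _ fun W => ?_)
  show transferKernel su2Rep β U (W * U) * Φ (W * U) = _
  rw [← stepIntegrand]; ring

/-- Integrability of the weighted step integrands `θ(W)·K(U,W·U)Φ(W·U)` for a measurable weight `0 ≤ θ ≤ 1`. [folklore] -/
theorem integrable_weight_mul_stepIntegrand (β : ℝ) {Φ : GaugeConfig 3 L SU2 → ℝ} (hΦ : Measurable Φ) {C : ℝ} (hC : ∀ V, |Φ V| ≤ C)
    (U : GaugeConfig 3 L SU2) {θ : GaugeConfig 3 L SU2 → ℝ} (hθ : Measurable θ) (hθ1 : ∀ W, |θ W| ≤ 1) :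
    Integrable (fun W => θ W * stepIntegrand β Φ U W) (configMeasure SU2 L) := by
  obtain ⟨B, hB⟩ := exists_abs_stepIntegrand_le β hC U
  refine integrable_of_bounded (hθ.mul (measurable_stepIntegrand β hΦ U)) (B := B) fun W => ?_
  rw [abs_mul]
  have := hθ1 W
  nlinarith [hB W, abs_nonneg (stepIntegrand β Φ U W), abs_nonneg (θ W)]

omit [NeZero L] in
/-- `|𝟙_near| ≤ 1` and `|1 − 𝟙_near| ≤ 1`. [folklore] -/
theorem abs_nearInd_le (δ : ℝ) (W : GaugeConfig 3 L SU2) : |nearInd δ W| ≤ 1 ∧ |1 - nearInd δ W| ≤ 1 := by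
  obtain ⟨h0, h1⟩ := nearInd_mem_Icc δ W
  exact ⟨abs_le.mpr ⟨by linarith, h1⟩, abs_le.mpr ⟨by linarith, by linarith⟩⟩

/-- ★ **THE FAR PART IS EXPONENTIALLY SMALL**: for `β ≥ 0` and `|Φ| ≤ C`,
`∫ (1 − 𝟙_near) K(U,W·U) Φ(W·U) dW ≤ e^{2β|E|} e^{−2βδ} C`. [cite: SeilerLNP1982, §3] -/
theorem far_integral_le {β : ℝ} (hβ : 0 ≤ β) (δ : ℝ) {Φ : GaugeConfig 3 L SU2 → ℝ} (hΦ : Measurable Φ) {C : ℝ}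
    (hC : ∀ V, |Φ V| ≤ C) (U : GaugeConfig 3 L SU2) :
    ∫ W, (1 - nearInd δ W) * stepIntegrand β Φ U W ∂configMeasure SU2 L ≤
      Real.exp (2 * β) ^ Fintype.card (Edge 3 L) * Real.exp (-(2 * β * δ)) * C := by
  have hC0 : 0 ≤ C := (abs_nonneg _).trans (hC 1)
  have hpt : ∀ W, (1 - nearInd δ W) * stepIntegrand β Φ U W ≤
      Real.exp (2 * β) ^ Fintype.card (Edge 3 L) * Real.exp (-(2 * β * δ)) * C := fun W => by
    by_cases h : W ∈ nearSet δ
    · rw [nearInd_of_mem h, sub_self, zero_mul]; positivity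
    · rw [nearInd_of_not_mem h, sub_zero, one_mul]
      obtain ⟨e₀, he⟩ := exists_far_of_not_mem h
      exact (le_abs_self _).trans (step_integrand_le_of_far hβ U W he hC)
  have hint := integrable_weight_mul_stepIntegrand β hΦ hC U (measurable_const.sub (measurable_nearInd δ))
    fun W => (abs_nearInd_le δ W).2
  calc ∫ W, (1 - nearInd δ W) * stepIntegrand β Φ U W ∂configMeasure SU2 L
      ≤ ∫ _W, Real.exp (2 * β) ^ Fintype.card (Edge 3 L) * Real.exp (-(2 * β * δ)) * C ∂configMeasure SU2 L :=
        integral_mono hint (integrable_const _) hpt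
    _ = Real.exp (2 * β) ^ Fintype.card (Edge 3 L) * Real.exp (-(2 * β * δ)) * C := by simp

/-- The far part is non-negative for `Φ ≥ 0`. [folklore] -/
theorem far_integral_nonneg (β δ : ℝ) {Φ : GaugeConfig 3 L SU2 → ℝ} (hΦ0 : ∀ V, 0 ≤ Φ V) (U : GaugeConfig 3 L SU2) :
    0 ≤ ∫ W, (1 - nearInd δ W) * stepIntegrand β Φ U W ∂configMeasure SU2 L :=
  integral_nonneg fun W => mul_nonneg (by linarith [(nearInd_mem_Icc δ W).2])
    (mul_nonneg (transferKernel_pos su2Rep β U (W * U)).le (hΦ0 _))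

/-- ★ **TWO-SIDED PACKAGING**: for `β ≥ 0`, `0 ≤ Φ ≤ C` measurable,
`∫ 𝟙_near K Φ ≤ K_βΦ(U) ≤ ∫ 𝟙_near K Φ + e^{2β|E|}e^{−2βδ} C`. [cite: SeilerLNP1982, §3] -/
theorem transferApply_near_sandwich {β : ℝ} (hβ : 0 ≤ β) (δ : ℝ) {Φ : GaugeConfig 3 L SU2 → ℝ} (hΦ : Measurable Φ)
    (hΦ0 : ∀ V, 0 ≤ Φ V) {C : ℝ} (hC : ∀ V, Φ V ≤ C) (U : GaugeConfig 3 L SU2) :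
    (∫ W, nearInd δ W * stepIntegrand β Φ U W ∂configMeasure SU2 L) ≤ transferApply β Φ U ∧
      transferApply β Φ U ≤
        (∫ W, nearInd δ W * stepIntegrand β Φ U W ∂configMeasure SU2 L) +
          Real.exp (2 * β) ^ Fintype.card (Edge 3 L) * Real.exp (-(2 * β * δ)) * C := by
  have hC' : ∀ V, |Φ V| ≤ C := fun V => abs_le.mpr ⟨by linarith [hΦ0 V, hΦ0 1, hC 1], hC V⟩
  rw [transferApply_eq_near_add_far β δ hΦ hC' U]
  exact ⟨le_add_of_nonneg_right (far_integral_nonneg β δ hΦ0 U), by linarith [far_integral_le hβ δ hΦ hC' U]⟩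

/-! ## §3 The near part in the gnomonic chart -/

/-- ★ **THE NEAR PART LIVES ON THE VACUUM PATTERN OF THE GNOMONIC CHART**: for `δ < 1` and bounded measurable `Φ`,
`∫ 𝟙_near(W) K(U,W·U) Φ(W·U) dW = ∫_{(E → ℝ³)} (∏_e w(y_e)) · 𝟙_near(P y) K(U, P(y)·U) Φ(P(y)·U) dy`, `P y = latPatternChart (fun _ ↦ false) y`.
[cite: SeilerLNP1982, §3] -/
theorem near_integral_eq_chart (β : ℝ) {δ : ℝ} (hδ : δ < 1) {Φ : GaugeConfig 3 L SU2 → ℝ} (hΦ : Measurable Φ) {C : ℝ}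
    (hC : ∀ V, |Φ V| ≤ C) (U : GaugeConfig 3 L SU2) :
    ∫ W, nearInd δ W * stepIntegrand β Φ U W ∂configMeasure SU2 L =
      ∫ y : Edge 3 L → Fin 3 → ℝ, latGnDensityReal L y *
        (nearInd δ (latPatternChart L (fun _ => false) y) * stepIntegrand β Φ U (latPatternChart L (fun _ => false) y)) := by
  obtain ⟨B, hB⟩ := exists_abs_stepIntegrand_le β hC U
  refine integral_configMeasure_eq_vacuumChart L ((measurable_nearInd δ).mul (measurable_stepIntegrand β hΦ U)) ⟨B, fun W => ?_⟩
    fun V ⟨e, he⟩ => ?_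
  · rw [abs_mul]
    have := (abs_nearInd_le δ W).1
    nlinarith [hB W, abs_nonneg (stepIntegrand β Φ U W), abs_nonneg (nearInd δ W)]
  · have hV : V ∉ nearSet δ := fun h => absurd (scalarPart_pos_of_mem hδ h e) (not_lt.mpr he)
    rw [nearInd_of_not_mem hV, zero_mul]

omit [NeZero L] in
/-- In the chart, NEAR ⟺ `(1−δ)²·(1 + |y_e|²) ≤ 1` on every link (for `δ ≤ 1`). [folklore] -/
theorem mem_nearSet_chart_iff {δ : ℝ} (hδ : δ ≤ 1) (y : Edge 3 L → Fin 3 → ℝ) :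
    latPatternChart L (fun _ => false) y ∈ nearSet δ ↔ ∀ e, (1 - δ) ^ 2 * (1 + ∑ a, y e a ^ 2) ≤ 1 := by
  rw [mem_nearSet_iff]
  refine forall_congr' fun e => ?_
  rw [latPatternChart_false]
  obtain ⟨hs, hsq, -⟩ := gnoPoint_chart (y e)
  set s := scalarPart (gnoPoint (y e)) with hs_def
  have hA : 0 ≤ ∑ a, y e a ^ 2 := Finset.sum_nonneg fun a _ => sq_nonneg _
  constructor
  · intro h
    have h1 : 1 - δ ≤ s := by linarith
    have h2 : (1 - δ) ^ 2 ≤ s ^ 2 := pow_le_pow_left₀ (by linarith) h1 2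
    nlinarith
  · intro h
    -- `(1−δ)²(1+A) ≤ s²(1+A)` with `1 + A > 0` gives `(1−δ)² ≤ s²`, hence `1 − δ ≤ s` as `s > 0`
    have h2 : (1 - δ) ^ 2 ≤ s ^ 2 := by
      by_contra hlt
      have hlt' : s ^ 2 < (1 - δ) ^ 2 := not_le.mp hlt
      nlinarith
    have h3 : 1 - δ ≤ s := (pow_le_pow_iff_left₀ (by linarith) hs.le two_ne_zero).mp h2
    linarith

omit [NeZero L] in
/-- On a near step of the chart every link coordinate lies in the ball `|y_e|² ≤ (1−δ)⁻² − 1` (`δ < 1`). [folklore] -/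
theorem sum_sq_le_of_near_chart {δ : ℝ} (hδ : δ < 1) {y : Edge 3 L → Fin 3 → ℝ} (h : latPatternChart L (fun _ => false) y ∈ nearSet δ)
    (e : Edge 3 L) : ∑ a, y e a ^ 2 ≤ ((1 - δ) ^ 2)⁻¹ - 1 := by
  have h1 := (mem_nearSet_chart_iff hδ.le y).mp h e
  have hpos : 0 < (1 - δ) ^ 2 := by nlinarith
  rw [le_sub_iff_add_le, le_inv_comm₀ (by positivity) hpos]
  · calc (1 - δ) ^ 2 = (1 - δ) ^ 2 * (1 + ∑ a, y e a ^ 2) * (1 + ∑ a, y e a ^ 2)⁻¹ := by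
          rw [mul_assoc, mul_inv_cancel₀ (by positivity), mul_one]
      _ ≤ 1 * (1 + ∑ a, y e a ^ 2)⁻¹ := mul_le_mul_of_nonneg_right h1 (by positivity)
      _ = (∑ a, y e a ^ 2 + 1)⁻¹ := by rw [one_mul, add_comm]

omit [NeZero L] in
/-- Conversely, inside the ball `(1−δ)²(1+ρ²) ≤ 1` every chart step is near. [folklore] -/
theorem mem_nearSet_chart_of_sum_sq_le {δ ρ : ℝ} (hδ : δ ≤ 1) (hρ : (1 - δ) ^ 2 * (1 + ρ ^ 2) ≤ 1) {y : Edge 3 L → Fin 3 → ℝ}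
    (hy : ∀ e, ∑ a, y e a ^ 2 ≤ ρ ^ 2) : latPatternChart L (fun _ => false) y ∈ nearSet δ := by
  refine (mem_nearSet_chart_iff hδ y).mpr fun e => le_trans ?_ hρ
  exact mul_le_mul_of_nonneg_left (by linarith [hy e]) (sq_nonneg _)

omit [NeZero L] in
/-- The vacuum chart at the origin is the identity configuration: `P 0 = 1`. [folklore] -/
theorem latPatternChart_zero : latPatternChart L (fun _ => false) (0 : Edge 3 L → Fin 3 → ℝ) = 1 := by
  funext e
  rw [latPatternChart_false]
  exact gnoPoint_zero

end Summit.QuantumFields.YangMills.Theorems.FemtoTransferGap.TwoLattice.Cov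

end
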